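import Summits.Ventures.CertifiedManyBodySolver.Rows.CorrWindowCertKernelChainQuotAdj
import Summits.Ventures.CertifiedManyBodySolver.Rows.CorrWindowCertKernelChainQuotCloser
import HarnessLib

/-!
# The CLOSER of the hinted-quotient + adjoint chain (`stepEQA`, `Rows/CorrWindowCertKernelChainQuotAdj.lean`)

HONEST FRAMING: Lean plumbing towards «tier P», companion of `Rows/CorrWindowCertKernelChainQuotAdj.lean` (400-line rule): the closer
**`affineOrbitLowerRowN_of_quotAdjChainKernelCertTB`** — data of `affineOrbitLowerRowN_of_quotChainKernelCertTB`
(`Rows/CorrWindowCertKernelChainQuotCloser.lean`) with `ChainQAOK` in place of `ChainQOK`; the accepted hints are the licensed-move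
family and the RECORDED ADJOINT GENERATORS extend the instance's anti-Hermitian list `AV` (`termOp_residTG_moves_adj`), then
`affineOrbitLowerRowN_of_residPolyG` (p669665). The instance supplies neither symmetry nor adjoint data. Nothing of record moves; no
claim node is discharged; CONTROL/CALIBRATION context (wording (xx1)); silent on the presence of superconductivity; not a `T_c` or phase
sentence; nothing about any material; no summit statement is proved by this file. Seat hubbard-obs-p2 (STIFFNESS),
`prover-hubbard-obs-p2-g23-0`, zero compute. STEP-0 instance: `Certificates/HubbardSquare_tpm3o10_U29o5_toyKernelCert_hopRowQuotAdj.lean`.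

References: X. Han, arXiv:2006.06002 §3 [Han2020Bootstrap]; J. Wang et al., PRX 14 (2024) 031006 §III [WangEtAl2024]; C. Jansson,
D. Chaykin, C. Keil, SIAM J. Numer. Anal. 46 (2008) 180 [JanssonChaykinKeil2008].
-/

namespace Summit.Ventures.CertifiedManyBodySolver

namespace CARPolyWindow

open Summit.Ventures.CertifiedQuantumChemistry Summit.Ventures.CertifiedQuantumChemistry.CARPoly
open Literature.MathematicalPhysics.QuantumLattice Literature.MathematicalPhysics.QuantumLattice.HubbardWave0
open Literature.MathematicalPhysics.QuantumManyBody.StateRelaxation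
open Literature.Probability.LatticeModels ThermodynamicLimit Filter Topology
open Matrix
open scoped ComplexOrder BigOperators

/-! ## The closer -/

noncomputable section QuotAdjCloser

variable {N Nβ : ℕ} [NeZero N]

/-- **HINTED-QUOTIENT + ADJOINT STAGED KERNEL FORM, TWO-LEVEL GRAM: a `stepEQA` chain over the regrouped sliced residual WITHOUT
symmetry slices, started from the empty accumulator (the symmetry family is built from the ACCEPTED hints, the anti-Hermitian family is
the instance's `AV` EXTENDED by the recorded adjoint generators), + the table facts of the geometry +
`q ≤ lowerConst (decPoly N C_M) + (Σμ)(n₀/2 − ν)` ⇒ `SquareTTPrimeCorrAffineOrbitLowerRowN tp U q hi lo κhi κlo s n₀ S Λ' (termOp d TX)`.**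
[cite: WangEtAl2024, §III] [cite: Han2020Bootstrap, §3] [cite: JanssonChaykinKeil2008, §3] -/
theorem affineOrbitLowerRowN_of_quotAdjChainKernelCertTB
    (tp U : ℚ) (hU : 0 ≤ U)
    {Λ Λ' : Finset (Site 2)} (hΛ : Λ ⊆ Λ') (h8 : thicken Λ 1 ⊆ Λ')
    (h0 : thicken ({0} : Finset (Site 2)) 1 ⊆ Λ') (hz : (0 : Site 2) ∈ Λ')
    {S : Finset (DihedralGroup 4)} (h1 : (1 : DihedralGroup 4) ∈ S) (hmul : ∀ a ∈ S, ∀ b ∈ S, a * b ∈ S)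
    -- tables and letters
    (D : QuotData N Nβ) (hxs : ∀ i, D.xs i ∈ Λ') (hix : ∀ y ∈ Λ', D.xs (D.ix y) = y)
    (hxsβ : ∀ j, D.xsβ j ∈ Λ) (hcovβ : ∀ x ∈ Λ, ∃ j, D.xsβ j = x)
    (d : Orb (Fin N) → Orb (PolySite Λ')) (hd : Function.Injective d)
    (hdx : ∀ i σ, d (orb i σ) = orb (PolySite.pt (D.xs i) (hxs i)) σ) (Bkey : ℕ)
    (dΛ : Orb (Fin Nβ) → Orb (PolySite Λ)) (hdΛ : ∀ j σ, dΛ (orb j σ) = orb (PolySite.pt (D.xsβ j) (hxsβ j)) σ)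
    (hf : ∀ b, d (D.f b) = Orb.embMap (PolySite.incl hΛ) (dΛ b))
    (sp : Orb (Fin N) → Fin 2) (hsp : ∀ a, (ofLex (d a)).2 = sp a)
    -- licensed moves: every `ok` code is in `S`, every `ok` move keeps the inner window inside the outer one (table form)
    (hokS : ∀ γc v, D.ok γc v = true → d4OfCode γc ∈ S)
    (hokV : ∀ γc v, D.ok γc v = true →
      ∀ j : Fin Nβ, D.xs (D.ix (d4Vec (d4OfCode γc) (D.xsβ j) + siteOfPair v)) = d4Vec (d4OfCode γc) (D.xsβ j) + siteOfPair v)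
    -- dictionaries
    (TH : Terms (Orb (Fin N))) (hH : termOp d TH = (hubbardTTPrimeFermionInteraction 1 tp U).localHamiltonian Λ')
    (TE : Terms (Orb (Fin N)))
    (hE : termOp d TE = fermionEmbed (PolySite.incl h0) ((hubbardTTPrimeFermionInteraction 1 tp U).meanEnergyObs 1))
    (o : Fin 2 → Orb (Fin N)) (ho : ∀ σ, d (o σ) = orb (PolySite.pt 0 hz) σ)
    -- certificate data (no symmetry family: it rides as hints)
    (TX : Terms (Orb (Fin N))) (μ : Fin 2 → ℚ) (ν κhi hi κlo lo : ℚ) (K : ℕ)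
    (blocks : List (List (List ℤ × Terms (Orb (Fin N))))) (EB : List (Terms (Orb (Fin Nβ))))
    (CW : Terms (Orb (Fin N))) (hcw : ∀ wc ∈ CW, chargeW wc.1 ≠ 0 ∨ spinChargeW sp wc.1 ≠ 0)
    (AV : List (Terms (Orb (Fin N))))
    -- the hinted chain
    (ns : List ℕ) (M : ℕ) (Cs : List SOSDual.EncPoly) (hC0 : Cs.getD 0 [] = []) (Hs : List (List (QHint Nβ)))
    (hchain : ChainQAOK D Bkey M Cs
      (groupSlices (residTGslices TX μ ν o κhi hi κlo lo TE (gramTBslices K blocks) TH D.f EB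
        (fun l : Fin 0 => l.elim0) (fun l : Fin 0 => l.elim0) CW AV) ns) Hs)
    -- the ONE rational inequality on the last accumulator
    {q s n₀ : ℚ} (hs : s = (μ 0 + μ 1) / 2)
    (hq : q ≤ lowerConst (SOSDual.decPoly N (Cs.getD M [])) + (μ 0 + μ 1) * (n₀ / 2 - ν)) :
    SquareTTPrimeCorrAffineOrbitLowerRowN (tp : ℝ) (U : ℝ) q hi lo κhi κlo s n₀ S Λ' (termOp d TX) := by
  -- the accepted move family
  set Ts := groupSlices (residTGslices TX μ ν o κhi hi κlo lo TE (gramTBslices K blocks) TH D.f EB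
    (fun l : Fin 0 => l.elim0) (fun l : Fin 0 => l.elim0) CW AV) ns with hTs
  set L := allMovesZ D Bkey Ts Hs M with hL
  set LA := allAdj D Bkey Ts Hs M with hLA
  -- every accepted move is licensed
  have hLok : ∀ n, ∀ mv ∈ allMovesZ D Bkey Ts Hs n, D.ok mv.1 mv.2.1 = true := by
    intro n
    induction n with
    | zero => intro mv hmv; rw [allMovesZ_zero] at hmv; exact absurd hmv List.not_mem_nil
    | succ n ih =>
      intro mv hmv
      rw [allMovesZ_succ, List.mem_append] at hmv
      rcases hmv with hmv | hmv
      · exact ih mv hmv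
      · rw [movesOfZ, quotMovesZ, List.mem_filterMap] at hmv
        obtain ⟨a, ha, hmap⟩ := hmv
        obtain ⟨e, hae, hFe⟩ := Option.map_eq_some_iff.1 hmap
        obtain ⟨hok, -, -⟩ := annotate_ok D Bkey _ _ a ha e hae
        rw [← hFe]
        exact hok
  let γf : Fin L.length → DihedralGroup 4 := fun l => d4OfCode (L.get l).1
  let wvf : Fin L.length → Site 2 := fun l => siteOfPair (L.get l).2.1
  let gf : Fin L.length → Orb (Fin Nβ) → Orb (Fin N) := fun l => gq D (γf l) (wvf l)
  let SYf : Fin L.length → Terms (Orb (Fin Nβ)) := fun l => (L.get l).2.2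
  have hγS : ∀ l, γf l ∈ S := fun l => hokS _ _ (hLok M _ (List.get_mem L l))
  have hsh : ∀ l, d4ShiftSet (γf l) (wvf l) Λ ⊆ Λ' := fun l =>
    shiftSet_subset_of_table D hxs hcovβ (γf l) (wvf l) (hokV _ _ (hLok M _ (List.get_mem L l)))
  have hg : ∀ l b, d (gf l b) = Orb.embMap (PolySite.incl (hsh l)) (Orb.embMap (PolySite.d4Emb (γf l) (wvf l) Λ) (dΛ b)) :=
    fun l b => by rw [← orb_ofLex_eq b]; exact d_gq D hxs d hdx hix hxsβ dΛ hdΛ (γf l) (wvf l) (hsh l) _ _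
  -- the semantic residual hypothesis WITH the accepted family
  have hTG : termOp d (gramTBslices K blocks).flatten = gramForm (gramTBCoef K blocks) (gramTBOp d blocks) := by
    rw [flatten_gramTBslices, termOp_gramTB_eq_gramForm]
  have hRsem : evalPoly d (SOSDual.decPoly N (Cs.getD M [])) =
      termOp d (residTG TX μ ν o κhi hi κlo lo TE (gramTBslices K blocks).flatten TH D.f EB gf SYf CW (AV ++ LA)) := by
    rw [evalPoly_chainQA_nil hd hC0 hchain, hTs, flatten_groupSlices, flatten_residTGslices,
      termOp_residTG_moves_adj d TX μ ν o κhi hi κlo lo TE _ TH D.f EB gf SYf CW AV LA, ← hL, ← hLA, termOp_symTL_eq]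
  exact affineOrbitLowerRowN_of_residPolyG tp U hU hΛ h8 h0 hz h1 hmul d dΛ D.f hf sp hsp TH hH TE hE o ho TX μ ν κhi hi κlo lo
    (gramTBslices K blocks).flatten (gramTBCoef_posSemidef K blocks) (gramTBOp d blocks) hTG EB γf hγS wvf hsh gf hg SYf CW hcw
    (AV ++ LA) hRsem hs hq

end QuotAdjCloser

end CARPolyWindow

end Summit.Ventures.CertifiedManyBodySolver
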